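import Summits.HubbardSuperconductivity.HubbardSuperconductivity.Theorems.AnisotropyChordTransferFibre3RateLemma

/-!
# Route `AnisotropyChord` / H0 rotor rung: PartN39 — the two ℤ² lattice-sum ingredients of the SHELL MAJORANT, PROVED

PORT PartN39 (`…Fibre3RateLemma`, theory seat `hubbard-h0-rotor-theory-1` g21, memo 21 §321(a)(2)) types
* `RotationPairing` — on the rotation-symmetric punctured box, `Σ (m·r)²/|m|⁴ = ½|r|² Σ 1/|m|²` (pair `m` with `m⊥ = (−m₂, m₁)`);
* `RingCountBound` — `Σ_{0<|m|∞≤N} 1/|m|² ≤ 8(ln N + 1)` (`8n` points on the ring `|m|∞ = n`, each `|m| ≥ n`; `H_N ≤ ln N + 1`).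
This file proves both (`rotationPairing_holds`, `ringCountBound_holds`); the second by induction on `N` through
`Σ_{puncturedBox N} 1/|m|² ≤ 8·H_N` (the ring `puncturedBox (N+1) ∖ puncturedBox N` has `8(N+1)` points with `|m|² ≥ (N+1)²`)
and Mathlib's `harmonic_le_one_add_log`.
Prover seat `hubbard-h0-rotor-p2` g0; helper for stmt-HubbardSuperconductivity-19089 (`--supports`, helper class).
WHAT THIS IS NOT: nothing here proves superconductivity in the Hubbard model; helper lemmas of ONE conditional reduction
(rung 19089, HOLE₂(.75) near-pair tail, RATE lemma).  Mathlib + tree imports only; no sorry, no axioms.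
-/

set_option linter.dupNamespace false

noncomputable section

namespace Summit.HubbardSuperconductivity.HubbardSuperconductivity.Theorems.AnisotropyChord.Transfer.Fibre3

namespace RateLemma

open Finset

/-- membership in the punctured box, unfolded. -/
theorem mem_puncturedBox (N : ℕ) (m : ℤ × ℤ) :
    m ∈ puncturedBox N ↔ m ≠ (0, 0) ∧ (-(N : ℤ) ≤ m.1 ∧ m.1 ≤ N) ∧ (-(N : ℤ) ≤ m.2 ∧ m.2 ≤ N) := by
  simp only [puncturedBox, Finset.mem_erase, Finset.mem_product, Finset.mem_Icc]

/-- the quarter rotation `m ↦ m⊥ = (−m₂, m₁)` preserves the punctured box. -/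
theorem rot_mem (N : ℕ) (m : ℤ × ℤ) (hm : m ∈ puncturedBox N) : (-m.2, m.1) ∈ puncturedBox N := by
  rw [mem_puncturedBox] at hm ⊢
  obtain ⟨h0, ⟨h1, h2⟩, ⟨h3, h4⟩⟩ := hm
  refine ⟨?_, ⟨by omega, by omega⟩, ⟨h1, h2⟩⟩
  intro h
  apply h0
  simp only [Prod.mk.injEq] at h
  ext <;> simp <;> omega

/-- the inverse rotation `m ↦ (m₂, −m₁)` preserves the punctured box. -/
theorem rot'_mem (N : ℕ) (m : ℤ × ℤ) (hm : m ∈ puncturedBox N) : (m.2, -m.1) ∈ puncturedBox N := by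
  rw [mem_puncturedBox] at hm ⊢
  obtain ⟨h0, ⟨h1, h2⟩, ⟨h3, h4⟩⟩ := hm
  refine ⟨?_, ⟨h3, h4⟩, ⟨by omega, by omega⟩⟩
  intro h
  apply h0
  simp only [Prod.mk.injEq] at h
  ext <;> simp <;> omega

/-- `a/a² = 1/a` in `ℝ` (also at `a = 0`). -/
theorem div_sq_self (a : ℝ) : a / a ^ 2 = 1 / a := by
  rcases eq_or_ne a 0 with h | h
  · simp [h]
  · field_simp

/-- ★ `RotationPairing` holds. -/
theorem rotationPairing_holds : RotationPairing := by
  intro N x y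
  set S := puncturedBox N with hS
  set f : ℤ × ℤ → ℝ := fun m =>
    (((m.1 * x + m.2 * y : ℤ) : ℝ)) ^ 2 / ((((m.1 ^ 2 + m.2 ^ 2 : ℤ)) : ℝ)) ^ 2 with hf
  set g : ℤ × ℤ → ℝ := fun m =>
    (((-m.2 * x + m.1 * y : ℤ) : ℝ)) ^ 2 / ((((m.1 ^ 2 + m.2 ^ 2 : ℤ)) : ℝ)) ^ 2 with hg
  -- Σ f = Σ g by the rotation m ↦ (−m₂, m₁)
  have hfg : ∑ m ∈ S, f m = ∑ m ∈ S, g m := by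
    refine Finset.sum_nbij' (fun m => (m.2, -m.1)) (fun m => (-m.2, m.1)) ?_ ?_ ?_ ?_ ?_
    · intro m hm; exact rot'_mem N m hm
    · intro m hm; exact rot_mem N m hm
    · intro m _; simp
    · intro m _; simp
    · intro m _
      simp only [hf, hg]
      congr 1
      · push_cast; ring
      · push_cast; ring
  -- f + g = |r|² |m|²/|m|⁴ = |r|²/|m|²
  have hsum : ∀ m ∈ S, f m + g m = ((x : ℝ) ^ 2 + (y : ℝ) ^ 2) * (1 / (((m.1 ^ 2 + m.2 ^ 2 : ℤ)) : ℝ)) := by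
    intro m _
    simp only [hf, hg]
    rw [← div_sq_self]
    push_cast
    ring
  have h2 : 2 * ∑ m ∈ S, f m = ((x : ℝ) ^ 2 + (y : ℝ) ^ 2) * ∑ m ∈ S, 1 / (((m.1 ^ 2 + m.2 ^ 2 : ℤ)) : ℝ) := by
    rw [two_mul, Finset.mul_sum]
    nth_rewrite 2 [hfg]
    rw [← Finset.sum_add_distrib]
    exact Finset.sum_congr rfl hsum
  show ∑ m ∈ S, f m = _
  linarith

/-! ## The ring count -/

/-- the boxes are nested. -/
theorem puncturedBox_mono (N : ℕ) : puncturedBox N ⊆ puncturedBox (N + 1) := by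
  intro m hm
  rw [mem_puncturedBox] at hm ⊢
  obtain ⟨h0, ⟨h1, h2⟩, ⟨h3, h4⟩⟩ := hm
  push_cast
  exact ⟨h0, ⟨by omega, by omega⟩, ⟨by omega, by omega⟩⟩

/-- cardinality of the punctured box: `(2N+1)² − 1 = 4N(N+1)`. -/
theorem card_puncturedBox (N : ℕ) : (puncturedBox N).card = 4 * N * (N + 1) := by
  unfold puncturedBox
  have hmem : ((0 : ℤ), (0 : ℤ)) ∈ (Finset.Icc (-(N : ℤ)) N) ×ˢ (Finset.Icc (-(N : ℤ)) N) := by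
    simp
  rw [Finset.card_erase_of_mem hmem, Finset.card_product, Int.card_Icc]
  have : ((N : ℤ) + 1 - -(N : ℤ)).toNat = 2 * N + 1 := by
    have e : ((N : ℤ) + 1 - -(N : ℤ)) = ((2 * N + 1 : ℕ) : ℤ) := by push_cast; ring
    rw [e, Int.toNat_natCast]
  rw [this, show (2 * N + 1) * (2 * N + 1) = 4 * N * (N + 1) + 1 by ring, Nat.add_sub_cancel]

/-- on the ring `puncturedBox (N+1) ∖ puncturedBox N` every point has `|m|² ≥ (N+1)²`. -/
theorem ring_normSq_ge (N : ℕ) (m : ℤ × ℤ) (hm : m ∈ puncturedBox (N + 1) \ puncturedBox N) :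
    ((N : ℝ) + 1) ^ 2 ≤ (((m.1 ^ 2 + m.2 ^ 2 : ℤ)) : ℝ) := by
  rw [Finset.mem_sdiff, mem_puncturedBox, mem_puncturedBox] at hm
  obtain ⟨⟨h0, ⟨h1, h2⟩, ⟨h3, h4⟩⟩, hn⟩ := hm
  push_cast at h1 h2 h3 h4
  have key : ((N : ℤ) + 1) ^ 2 ≤ m.1 ^ 2 + m.2 ^ 2 := by
    by_cases ha : -(N : ℤ) ≤ m.1 ∧ m.1 ≤ N
    · have hb : ¬ (-(N : ℤ) ≤ m.2 ∧ m.2 ≤ N) := fun hb => hn ⟨h0, ha, hb⟩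
      have : m.2 = N + 1 ∨ m.2 = -(N + 1) := by omega
      rcases this with h | h <;> nlinarith [sq_nonneg m.1]
    · have : m.1 = N + 1 ∨ m.1 = -(N + 1) := by omega
      rcases this with h | h <;> nlinarith [sq_nonneg m.2]
  have : (((N : ℤ) + 1) ^ 2 : ℤ) ≤ ((m.1 ^ 2 + m.2 ^ 2 : ℤ)) := key
  exact_mod_cast this

/-- `Σ_{puncturedBox N} 1/|m|² ≤ 8 H_N`. -/
theorem sum_inv_normSq_le_harmonic (N : ℕ) :
    (∑ m ∈ puncturedBox N, 1 / (((m.1 ^ 2 + m.2 ^ 2 : ℤ)) : ℝ)) ≤ 8 * (harmonic N : ℝ) := by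
  induction N with
  | zero =>
    have : puncturedBox 0 = ∅ := by decide
    simp [this]
  | succ N ih =>
    rw [← Finset.sum_sdiff (puncturedBox_mono N), harmonic_succ, Rat.cast_add, Rat.cast_inv, Rat.cast_natCast,
      Nat.cast_succ]
    -- the ring contribution
    have hring : (∑ m ∈ puncturedBox (N + 1) \ puncturedBox N, 1 / (((m.1 ^ 2 + m.2 ^ 2 : ℤ)) : ℝ))
        ≤ 8 / ((N : ℝ) + 1) := by
      have hN1 : (0 : ℝ) < (N : ℝ) + 1 := by positivity
      have hle : ∀ m ∈ puncturedBox (N + 1) \ puncturedBox N,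
          1 / (((m.1 ^ 2 + m.2 ^ 2 : ℤ)) : ℝ) ≤ 1 / ((N : ℝ) + 1) ^ 2 := by
        intro m hm
        exact one_div_le_one_div_of_le (by positivity) (ring_normSq_ge N m hm)
      have hcard : ((puncturedBox (N + 1) \ puncturedBox N).card : ℝ) = 8 * ((N : ℝ) + 1) := by
        rw [Finset.card_sdiff_of_subset (puncturedBox_mono N), card_puncturedBox, card_puncturedBox,
          show 4 * (N + 1) * (N + 1 + 1) = 8 * (N + 1) + 4 * N * (N + 1) by ring, Nat.add_sub_cancel]
        push_cast
        ring
      have h := Finset.sum_le_card_nsmul _ _ _ hle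
      rw [nsmul_eq_mul, hcard] at h
      calc _ ≤ 8 * ((N : ℝ) + 1) * (1 / ((N : ℝ) + 1) ^ 2) := h
        _ = 8 / ((N : ℝ) + 1) := by field_simp
    have : 8 / ((N : ℝ) + 1) = 8 * ((N : ℝ) + 1)⁻¹ := by rw [div_eq_mul_inv]
    linarith [hring, ih]

/-- ★ `RingCountBound` holds. -/
theorem ringCountBound_holds : RingCountBound := by
  intro N hN
  have h1 := sum_inv_normSq_le_harmonic N
  have h2 := harmonic_le_one_add_log N
  linarith

end RateLemma

end Summit.HubbardSuperconductivity.HubbardSuperconductivity.Theorems.AnisotropyChord.Transfer.Fibre3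

end
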